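import Literature.NumberTheory.EllipticCurves.KellerYin2024.AnomalousLambdaInvariants
import Literature.NumberTheory.GaloisRepresentations.TeichmullerCharacter
import Literature.NumberTheory.EllipticCurves.GaloisActionProofs
import Summits.BirchSwinnertonDyer.BirchSwinnertonDyer.Theorems.EisensteinPrimesFullDescentMultiplicativeUnipotentLine
import Summits.BirchSwinnertonDyer.BirchSwinnertonDyer.Theorems.EisensteinPrimesGoodLatticeQuotCharUnramifiedAtP
import Summits.BirchSwinnertonDyer.Rank1Residual.X2.GreenbergVatsalStrictSelmerMultiplicative
import Literature.NumberTheory.EllipticCurves.SemistableReductionBaseChange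
import HarnessLib

/-!
# The residual pair `(θsub, θquot)` of `E[p]` over `K` is UNRAMIFIED at every multiplicative place `w ∤ p`

Cell `bsd-eis`, width seat `bsd-line-x1-p1-w2` gen 23, crux 2 `GoodLatticeBDPValue` (stmt-BirchSwinnertonDyer-19032),
line `halves` v33N; helper `--supports`, closes no stub. PROVED, no named fact, no `sorry`.

WHY. The (eq:Euler-comp) step of Castella–Grossi–Lee–Skinner's proof of Thm. 2.2.2 (held text paper:arxiv-2008.02571
p. 12 L104–113) rewrites `λ(𝓔_{φ,ψ})`, `𝓔 = ∏ 𝒫_w(φ) ∏ 𝒫_w(ψ)`, through the congruences `a_ℓ ≡ φ(ℓ)`, `a_ℓ ≡ ψ(ℓ)`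
of Thm. 2.2.1 at the MULTIPLICATIVE primes `ℓ ∥ N` — where `φ, ψ` are unramified because inertia at a multiplicative
`ℓ ≠ p` acts unipotently on `E[p]` (Tate curve; Serre 1972 §1.12).  In the tree's closed-form currency the local term
`charLocalLambda S κ θ w = [Γ : Γ_w] · 𝟙[θ unramified at w ∧ θ(Frob_w) ≡ Nw]` (`KellerYin2024/AnticyclotomicLocalEulerFactors`)
carries the unramifiedness as a CONJUNCT; this file discharges it for the residual characters of the content stub 3a-A
(`∀ θsub θquot, IsResidualPairOver (W.baseChange K) p θsub θquot → …`) at every multiplicative place `w ∤ p` — item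
«θsub/θquot unramified at a multiplicative w ∤ p» of width seat -w2 g22's SIZING memo §2 (NOT found in the tree then).

PROOF. For `WK/K` elliptic over a number field, `w` multiplicative, `p ∉ w`, `𝔓 ∣ w` and `τ ∈ I_𝔓`: `τ` acts on
`E[p]` unipotently, `τ(τP − P) = τP − P` (width seat -w2 g5's `FullDescentMultiplicativeUnipotentLine.smul_smul_sub_eq_of_mem_inertia_geomTorsion`
over the tree's Tate-curve-free `WeierstrassCurve.smul_smul_sub_eq_of_mem_inertia_of_hasMultiplicativeReductionAt`).  On the
stable line `Φ` (order `p`) `τ` acts by an integer `a` with `(a − 1)² ≡ 0`, so `p ∣ a − 1` (§1 `dvd_sub_one_of_sq_smul_eq_zero`);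
on `E[p]/Φ` (order `p`, as `#E[p] = p²`, `card_torsionPoints_eq_sq_holds`) by `b` with `(b − 1)² E[p] ⊆ Φ`, so `p ∣ b − 1`.
The Teichmüller values `θsub(τ), θquot(τ) ∈ μ_{p−1}(𝓞)` are `≡ a, b ≡ 1 (mod 𝔪)`, hence `= 1` (Hensel,
`eq_of_pow_eq_one_of_norm_sub_lt_one`; §1 `apply_eq_one_of_entry_near_one`, with k5-c2's
`EisensteinPrimesMuLambda.norm_intCast_sub_one_lt_one_of_dvd`): §2 `apply_eq_one_of_mem_inertia`, §3
`isUnramifiedAt_of_hasMultiplicativeReductionAt` (stated for ANY elliptic `WK/K` over a number field); §4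
`isUnramifiedAt_baseChange_of_hasMultiplicativeReductionAtPrime`: the `E/ℚ`, `E_K = W.baseChange K`, `w ∋ ℓ ≠ p`,
`W.HasMultiplicativeReductionAtPrime ℓ` form read by the content stub (Silverman VII.5.4 (b): `E_K` multiplicative at `w`).

HONEST FRAMING: helper lemmas on the tree's own objects; 0 stubs / cells / labels / tiers move; orphan for -19032 until a
CGLS-2.2.1-shaped typing of 3a-A consumes it; no summit statement, no case of BSD, no crux or stub is proved here.
References: [SerreInventiones1972] §1.12; [SilvermanATAEC1994] V.4–V.5, Ex. 5.13 (b); [CastellaGrossiLeeSkinner2022]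
Thm. 2.2.1 / proof of Thm. 2.2.2; [KellerYin2024] §1.4, Lemma 1.1.1; [SerreLocalFields1979] II §4 Prop. 8.
-/

set_option autoImplicit false
-- `Summit.BirchSwinnertonDyer.BirchSwinnertonDyer.…`: the summit and its single sub-problem share a name (D-0017 layout).
set_option linter.dupNamespace false

noncomputable section

open scoped Classical

open NumberField IsDedekindDomain Field WeierstrassCurve Polynomial
open Literature.NumberTheory.EllipticCurves Literature.NumberTheory.GaloisRepresentations
open Literature.NumberTheory.EllipticCurves.KellerYin2024

namespace Summit.BirchSwinnertonDyer.BirchSwinnertonDyer.Theorems.ResidualPairUnramifiedAtMultiplicative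

variable {K : Type} [Field K] {p : ℕ} [hp : Fact p.Prime] {S : Set (PadicAlgCl p)}

/-! ## §1 Arithmetic of a unipotent scalar on a group of exponent `p` -/

/-- If an element `P` of additive order `p` satisfies `((c − 1)²) • P = 0` then `p ∣ c − 1`. [folklore] -/
theorem dvd_sub_one_of_sq_smul_eq_zero {M : Type*} [AddCommGroup M] {P : M} (hP : addOrderOf P = p) {c : ℤ}
    (h : ((c - 1) * (c - 1)) • P = 0) : (p : ℤ) ∣ c - 1 := by
  have hdvd : (p : ℤ) ∣ (c - 1) * (c - 1) := by
    rw [← hP]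
    exact addOrderOf_dvd_iff_zsmul_eq_zero.mpr h
  rcases Int.Prime.dvd_mul' hp.out hdvd with h1 | h1 <;> exact h1

/-- An element of a subgroup of prime order `p` which is not `0` has additive order `p`. [folklore] -/
theorem addOrderOf_eq_of_mem_of_ne_zero {M : Type*} [AddCommGroup M] {Φ : AddSubgroup M} (hΦ : Nat.card Φ = p)
    {P : M} (hP : P ∈ Φ) (hP0 : P ≠ 0) : addOrderOf P = p := by
  have h1 : addOrderOf P ∣ p := by
    rw [← hΦ, ← AddSubgroup.addOrderOf_mk P hP]
    exact addOrderOf_dvd_natCard _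
  rcases (Nat.dvd_prime hp.out).mp h1 with h | h
  · exact absurd (AddMonoid.addOrderOf_eq_one_iff.mp h) hP0
  · exact h

/-- **A Teichmüller value `≡ 1` is `1`**: for `θ : Γ_K → GL₁(𝓞)` with `θ(σ)^{p−1} = 1` and
`‖entry θ σ − a‖ < 1` for an integer `a ≡ 1 (mod p)`, `θ σ = 1` (Hensel: the `(p−1)`-th roots of unity are
incongruent modulo `𝔪`, `eq_of_pow_eq_one_of_norm_sub_lt_one`). [cite: SerreLocalFields1979, Ch. II §4, Prop. 8]
[cite: KellerYin2024, §1.1 (arXiv:2402.12781v2 TeX L441: Teichmüller lift)] -/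
theorem apply_eq_one_of_entry_near_one {θ : FramedGaloisRep K (padicCoeffIntegers S) 1}
    {σ : absoluteGaloisGroup K} (hpow : θ σ ^ (p - 1) = 1) {a : ℤ}
    (ha : ‖((entry S θ σ : padicCoeffIntegers S) : PadicAlgCl p) - (a : PadicAlgCl p)‖ < 1)
    (hdvd : (p : ℤ) ∣ a - 1) : θ σ = 1 := by
  have hdet : ((Matrix.GeneralLinearGroup.det (θ σ) : (padicCoeffIntegers S)ˣ) : padicCoeffIntegers S) =
      entry S θ σ := by
    rw [Matrix.GeneralLinearGroup.val_det_apply, Matrix.det_fin_one]; rfl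
  have hμ : ((entry S θ σ : padicCoeffIntegers S) : PadicAlgCl p) ^ (p - 1) = 1 := by
    rw [← Subring.coe_pow, ← hdet, ← Units.val_pow_eq_pow_val, ← map_pow, hpow, map_one, Units.val_one,
      Subring.coe_one]
  have hp1 : 0 < p - 1 := Nat.sub_pos_of_lt hp.out.one_lt
  have hpd : ¬ p ∣ (p - 1) := Nat.not_dvd_of_pos_of_lt hp1 (Nat.sub_lt hp.out.pos Nat.one_pos)
  have hclose : ‖((entry S θ σ : padicCoeffIntegers S) : PadicAlgCl p) - 1‖ < 1 := by
    have e : ((entry S θ σ : padicCoeffIntegers S) : PadicAlgCl p) - 1 =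
        (((entry S θ σ : padicCoeffIntegers S) : PadicAlgCl p) - (a : PadicAlgCl p)) + ((a : PadicAlgCl p) - 1) := by
      ring
    rw [e]
    refine (IsUltrametricDist.norm_add_le_max _ _).trans_lt (max_lt ha (EisensteinPrimesMuLambda.norm_intCast_sub_one_lt_one_of_dvd hdvd))
  have hentry : entry S θ σ = 1 :=
    Subtype.ext (eq_of_pow_eq_one_of_norm_sub_lt_one hp1 hpd hμ (one_pow _) hclose)
  refine Matrix.GeneralLinearGroup.ext fun i j ↦ ?_
  have hi : i = 0 := Subsingleton.elim i 0
  have hj : j = 0 := Subsingleton.elim j 0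
  subst hi hj
  rw [Units.val_one, Matrix.one_apply_eq]
  exact hentry

/-! ## §2 Inertia at a multiplicative `w ∤ p` acts trivially through the residual pair -/

variable [NumberField K]

/-- **`θsub(τ) = 1` and `θquot(τ) = 1` for `τ` in an inertia group above a multiplicative place `w ∤ p`.** For `WK/K`
elliptic over a number field, `(θsub, θquot)` a residual pair of `E[p]` over `K` (`IsResidualPairOver WK p θsub θquot`,
stable line `Φ`), `w` a place of multiplicative reduction with `p ∉ w`, `𝔓 ∣ w` a prime of `\bar ℤ_K` and `τ ∈ I_𝔓`:
`τ` is unipotent on `E[p]` (`FullDescentMultiplicativeUnipotentLine.smul_smul_sub_eq_of_mem_inertia_geomTorsion`), so its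
scalars `a` on `Φ` and `b` on `E[p]/Φ` are `≡ 1 (mod p)` and the Teichmüller values are `1`.
[cite: SerreInventiones1972, §1.12 (inertia at a multiplicative prime acts unipotently on E[p])]
[cite: SilvermanATAEC1994, V.4–V.5 and Exercise 5.13 (b)] [cite: KellerYin2024, §1.4 display (char to f) (arXiv:2402.12781v2 TeX L1066–1081)] -/
theorem apply_eq_one_of_mem_inertia (WK : WeierstrassCurve K) [WK.IsElliptic]
    {θsub θquot : FramedGaloisRep K (padicCoeffIntegers S) 1} (h : IsResidualPairOver WK p θsub θquot)
    {w : HeightOneSpectrum (𝓞 K)} (hmult : WK.HasMultiplicativeReductionAt w) (hpw : (p : 𝓞 K) ∉ w.asIdeal)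
    {𝔓 : Ideal (absIntegers (𝓞 K) K)} (h𝔓 : 𝔓 ∈ w.primesAbove) {τ : absoluteGaloisGroup K}
    (hτ : τ ∈ 𝔓.inertia (absoluteGaloisGroup K)) : θsub τ = 1 ∧ θquot τ = 1 := by
  obtain ⟨Φ, hcard, hle, hstab, hsub, hquot⟩ := h
  have hpP : p.Prime := hp.out
  -- unipotence of `τ` on `E[p]`
  have huni : ∀ P : geomPoints WK, P ∈ geomTorsion WK (p : ℤ) → τ • (τ • P - P) = τ • P - P := fun P hP ↦ by
    have := FullDescentMultiplicativeUnipotentLine.smul_smul_sub_eq_of_mem_inertia_geomTorsion WK hmult hpP hpw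
      h𝔓 hτ ⟨P, hP⟩
    simpa [AddSubgroup.torsionBy.coe_smul] using congrArg Subtype.val this
  have hτz : ∀ (k : ℤ) (x : geomPoints WK), τ • (k • x) = k • (τ • x) := fun k x ↦
    map_zsmul (DistribSMul.toAddMonoidHom _ τ) k x
  -- a non-zero point of `Φ`
  haveI : Finite Φ := Nat.finite_of_card_ne_zero (by rw [hcard]; exact hpP.ne_zero)
  obtain ⟨⟨P₀, hP₀Φ⟩, hP₀⟩ : ∃ P : Φ, P ≠ 0 := by
    by_contra hall
    push Not at hall
    haveI : Subsingleton Φ := ⟨fun a b ↦ by rw [hall a, hall b]⟩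
    have := hcard ▸ Nat.card_of_subsingleton (0 : Φ)
    exact hpP.one_lt.ne' this
  have hP₀ne : P₀ ≠ 0 := fun h0 ↦ hP₀ (Subtype.ext h0)
  have hordP₀ : addOrderOf P₀ = p := addOrderOf_eq_of_mem_of_ne_zero hcard hP₀Φ hP₀ne
  -- `θsub τ = 1`
  obtain ⟨a, ha, haΦ⟩ := hsub.2 τ
  have hτP₀ : τ • P₀ = a • P₀ := sub_eq_zero.mp (AddSubgroup.mem_bot.mp (haΦ P₀ hP₀Φ))
  have hsq : ((a - 1) * (a - 1)) • P₀ = 0 := by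
    have h1 := huni P₀ (hle hP₀Φ)
    rw [hτP₀, show a • P₀ - P₀ = (a - 1) • P₀ by rw [sub_smul, one_smul], hτz, hτP₀, smul_smul, ← sub_eq_zero,
      ← sub_smul] at h1
    rw [show (a - 1) * (a - 1) = (a - 1) * a - (a - 1) by ring]
    exact h1
  have ha1 : (p : ℤ) ∣ a - 1 := dvd_sub_one_of_sq_smul_eq_zero hordP₀ hsq
  have hsub1 : θsub τ = 1 := apply_eq_one_of_entry_near_one (hsub.1 τ) ha ha1
  -- `τ` acts trivially on `Φ`
  have hτΦ : ∀ Q ∈ Φ, τ • Q = Q := fun Q hQ ↦ by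
    have hτQ : τ • Q = a • Q := sub_eq_zero.mp (AddSubgroup.mem_bot.mp (haΦ Q hQ))
    obtain ⟨c, hc⟩ := ha1
    have hpQ : (p : ℤ) • Q = 0 := (mem_geomTorsion_iff WK (p : ℤ) Q).mp (hle hQ)
    have hac : a = 1 + c * (p : ℤ) := by linarith [hc, mul_comm (p : ℤ) c]
    rw [hτQ, hac, add_smul, one_smul, mul_smul, hpQ, smul_zero, add_zero]
  -- a point of `E[p]` outside `Φ`
  refine ⟨hsub1, ?_⟩
  obtain ⟨b, hb, hbΦ⟩ := hquot.2 τ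
  haveI : CharZero (AlgebraicClosure K) :=
    charZero_of_injective_algebraMap (algebraMap K (AlgebraicClosure K)).injective
  have hcardE : Nat.card (geomTorsion WK (p : ℤ)) = p ^ 2 :=
    card_torsionPoints_eq_sq_holds WK (AlgebraicClosure K) (Nat.cast_ne_zero.mpr hpP.ne_zero)
  obtain ⟨P₁, hP₁E, hP₁Φ⟩ : ∃ P : geomPoints WK, P ∈ geomTorsion WK (p : ℤ) ∧ P ∉ Φ := by
    by_contra hall
    push Not at hall
    have hle' : geomTorsion WK (p : ℤ) ≤ Φ := fun P hP ↦ hall P hP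
    have h1 : p ^ 2 ∣ p := by
      have h0 := AddSubgroup.card_dvd_of_le hle'
      rwa [hcardE, hcard] at h0
    have h2 : p ^ 2 ≤ p := Nat.le_of_dvd hpP.pos h1
    have h3 : p < p ^ 2 := by nlinarith [hpP.one_lt]
    omega
  -- `(b − 1)² • P₁ ∈ Φ`
  obtain ⟨φ₁, hφ₁Φ, hτP₁⟩ : ∃ φ₁ ∈ Φ, τ • P₁ = b • P₁ + φ₁ :=
    ⟨τ • P₁ - b • P₁, hbΦ P₁ hP₁E, by abel⟩
  have hsqΦ : ((b - 1) * (b - 1)) • P₁ ∈ Φ := by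
    have h1 := huni P₁ hP₁E
    have e1 : τ • P₁ - P₁ = (b - 1) • P₁ + φ₁ := by rw [hτP₁, sub_smul, one_smul]; abel
    rw [e1, smul_add, hτz, hτP₁, hτΦ φ₁ hφ₁Φ, smul_add, smul_smul] at h1
    -- `((b-1) b) • P₁ + (b-1) • φ₁ + φ₁ = (b-1) • P₁ + φ₁`
    have e2 : ((b - 1) * (b - 1)) • P₁ = -((b - 1) • φ₁) := by
      have h2 : ((b - 1) * b) • P₁ + (b - 1) • φ₁ = (b - 1) • P₁ := add_right_cancel h1
      have h3 : ((b - 1) * b) • P₁ - (b - 1) • P₁ = -((b - 1) • φ₁) := by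
        rw [sub_eq_iff_eq_add]; rw [← h2]; abel
      rw [show (b - 1) * (b - 1) = (b - 1) * b - (b - 1) by ring, sub_smul]
      exact h3
    rw [e2]
    exact Φ.neg_mem (Φ.zsmul_mem hφ₁Φ _)
  -- hence `p ∣ b − 1` (else `P₁ ∈ Φ`)
  have hb1 : (p : ℤ) ∣ b - 1 := by
    by_contra hnd
    apply hP₁Φ
    -- `(b-1)²` is invertible mod `p`
    have hcop : IsCoprime ((b - 1) * (b - 1)) (p : ℤ) := by
      have h1 : IsCoprime (b - 1) (p : ℤ) :=
        ((Prime.coprime_iff_not_dvd (Nat.prime_iff_prime_int.mp hpP)).mpr hnd).symm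
      exact h1.mul_left h1
    obtain ⟨u, v, huv⟩ := hcop
    have hpP₁ : (p : ℤ) • P₁ = 0 := (mem_geomTorsion_iff WK (p : ℤ) P₁).mp hP₁E
    have e : P₁ = u • (((b - 1) * (b - 1)) • P₁) + v • ((p : ℤ) • P₁) := by
      rw [smul_smul, smul_smul, ← add_smul, huv, one_smul]
    rw [e, hpP₁, smul_zero, add_zero]
    exact Φ.zsmul_mem hsqΦ u
  exact apply_eq_one_of_entry_near_one (hquot.1 τ) hb hb1

/-! ## §3 The residual pair is unramified at a multiplicative `w ∤ p` -/

/-- **The residual characters are unramified at every multiplicative place `w ∤ p`**: for `WK/K` elliptic over a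
number field and a residual pair `(θsub, θquot)` of `E[p]` over `K`, at a place `w` of multiplicative reduction with
`p ∉ w` both `θsub` and `θquot` are unramified (`FramedGaloisRep.IsUnramifiedAt`). In print (`E/ℚ`, CGLS Thm. 2.2.1 at
`ℓ ∥ N`): `φ, ψ` are unramified at `ℓ ≠ p` multiplicative, inertia acting unipotently on the Tate module.
[cite: SerreInventiones1972, §1.12] [cite: CastellaGrossiLeeSkinner2022, Thm. 2.2.1 (congruences a_ℓ ≡ φ(ℓ), ψ(ℓ) at ℓ ∥ N) and proof of Thm. 2.2.2 (eq:Euler-comp)] -/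
theorem isUnramifiedAt_of_hasMultiplicativeReductionAt (WK : WeierstrassCurve K) [WK.IsElliptic]
    {θsub θquot : FramedGaloisRep K (padicCoeffIntegers S) 1} (h : IsResidualPairOver WK p θsub θquot)
    {w : HeightOneSpectrum (𝓞 K)} (hmult : WK.HasMultiplicativeReductionAt w) (hpw : (p : 𝓞 K) ∉ w.asIdeal) :
    θsub.IsUnramifiedAt w ∧ θquot.IsUnramifiedAt w :=
  ⟨fun _ h𝔓 _ hτ ↦ (apply_eq_one_of_mem_inertia WK h hmult hpw h𝔓 hτ).1,
    fun _ h𝔓 _ hτ ↦ (apply_eq_one_of_mem_inertia WK h hmult hpw h𝔓 hτ).2⟩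

/-! ## §4 `E/ℚ`: the residual pair over `K` is unramified above every multiplicative `ℓ ≠ p` -/

omit [NumberField K] in
/-- Two distinct rational primes do not lie in the same finite place. [folklore] -/
theorem not_natCast_mem_of_natCast_mem_of_ne {ℓ q : ℕ} (hℓ : ℓ.Prime) (hq : q.Prime) (hne : ℓ ≠ q)
    {w : HeightOneSpectrum (𝓞 K)} (hw : ((ℓ : ℕ) : 𝓞 K) ∈ w.asIdeal) : ((q : ℕ) : 𝓞 K) ∉ w.asIdeal := by
  intro hqw
  have hcop : IsCoprime ((ℓ : ℤ) : 𝓞 K) ((q : ℤ) : 𝓞 K) :=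
    (Nat.isCoprime_iff_coprime.mpr ((Nat.coprime_primes hℓ hq).mpr hne)).intCast
  obtain ⟨a, b, hab⟩ := hcop
  apply w.isPrime.ne_top
  rw [Ideal.eq_top_iff_one, ← hab]
  simp only [Int.cast_natCast]
  exact w.asIdeal.add_mem (w.asIdeal.mul_mem_left a hw) (w.asIdeal.mul_mem_left b hqw)

/-- **For `E/ℚ` and any number field `K`: the residual pair of `E[p]` over `K` is unramified at every
place `w` of `K` above a prime `ℓ ≠ p` of MULTIPLICATIVE reduction of `E`** (`E_K` is multiplicative at
`w`, Silverman VII.5.4 (b), tree `hasMultiplicativeReductionAt_baseChange_of_liesOver`; then §3). The form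
read by the content stub 3a-A (`IsResidualPairOver (W.baseChange K) p θsub θquot`, `ℓ ∥ N_E`).
[cite: SilvermanAEC2009, VII.5 Prop. 5.4 (b) and Prop. 5.1 (b)] [cite: SerreInventiones1972, §1.12]
[cite: CastellaGrossiLeeSkinner2022, Thm. 2.2.1 (ℓ ∥ N) and proof of Thm. 2.2.2 (eq:Euler-comp)] -/
theorem isUnramifiedAt_baseChange_of_hasMultiplicativeReductionAtPrime (W : WeierstrassCurve ℚ)
    [W.IsElliptic] {θsub θquot : FramedGaloisRep K (padicCoeffIntegers S) 1}
    (h : IsResidualPairOver (W.baseChange K) p θsub θquot) {ℓ : ℕ} [hℓ : Fact ℓ.Prime] (hℓp : ℓ ≠ p)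
    (hmult : W.HasMultiplicativeReductionAtPrime ℓ) {w : HeightOneSpectrum (𝓞 K)}
    (hw : ((ℓ : ℕ) : 𝓞 K) ∈ w.asIdeal) : θsub.IsUnramifiedAt w ∧ θquot.IsUnramifiedAt w := by
  haveI : (W.baseChange K).IsElliptic := by rw [WeierstrassCurve.baseChange]; infer_instance
  -- the place of `ℚ` below `w` contains `ℓ`, so `E` is multiplicative there, hence `E_K` at `w`
  let v : HeightOneSpectrum (𝓞 ℚ) := w.under (𝓞 ℚ)
  have hℓv : ((ℓ : ℕ) : 𝓞 ℚ) ∈ v.asIdeal := by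
    change ((ℓ : ℕ) : 𝓞 ℚ) ∈ w.asIdeal.comap (algebraMap (𝓞 ℚ) (𝓞 K))
    rw [Ideal.mem_comap, map_natCast]
    exact hw
  have hmultv : W.HasMultiplicativeReductionAt v :=
    Summit.BirchSwinnertonDyer.Rank1Residual.X2.GreenbergVatsalStrictSelmerMultiplicative.hasMultiplicativeReductionAt_of_mem
      W ℓ hmult hℓv
  haveI : w.asIdeal.LiesOver v.asIdeal := ⟨rfl⟩
  have hmultw : (W.baseChange K).HasMultiplicativeReductionAt w :=
    W.hasMultiplicativeReductionAt_baseChange_of_liesOver K (v := v) (w := w) hmultv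
  exact isUnramifiedAt_of_hasMultiplicativeReductionAt (W.baseChange K) h hmultw
    (not_natCast_mem_of_natCast_mem_of_ne hℓ.out hp.out hℓp hw)

end Summit.BirchSwinnertonDyer.BirchSwinnertonDyer.Theorems.ResidualPairUnramifiedAtMultiplicative

end
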